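import Mathlib
import HarnessLib
import HarnessLib.Audit
import Summits.AnomalousDissipation.Statement
import Literature.Analysis.FluidPDE.TaoCascadeOperator

/-!
Route: AveragedCascade

CLOSED (retired) 2026-08-15T13:36:03Z by operator:999:1090267 — reason: not-a-thesis: assembly does not conclude the sub-problem Statement — note: D-0027 §2.1 audit (human 2026-08-15: routes that do not decide the summit are removed): the assembly concludes `AveragedZerothLaw`, not the sub-problem statement; a NEW conforming route may be opened from the same idea (generated `closes : … → _root_.AnomalousDissipation`).. The file is kept as the record of this route; refuted decls are indexed as negative knowledge (`ledger negatives`).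

# Route AveragedCascade — AnomalousDissipation (= Literature.Turb.ZerothLaw), negative side: a
NONLINEARITY-ROBUST BARRIER (realises idea card averaged-ns-nonlinearity-robust-barrier)

## Thesis X (words)
There is a Tao-averaged Navier–Stokes system on ℝ³, ∂ₜu = νΔu + B̃(u,u) + f, with B̃ = 𝒜.form a
SYMMETRIC averaged Euler bilinear operator obeying the ENERGY CANCELLATION ⟨B̃(u,u),u⟩ = 0 (an
average over rotations, order-0 Fourier multipliers and dilations of the Euler form, hence obeying
every W^{s,p}/Besov/paraproduct estimate of B — Tao2016AveragedNS pp. 6–7) and ONE steady Schwartz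
divergence-free force f, viscosities ν_j → 0 and global mild H¹⁰_df solutions u_j with bounded
long-time mean energy and long-time mean dissipation ν_j⟨4π²‖u_j‖²_{Ḣ¹}⟩ ≥ ε > 0 — the exact twin of
Literature.Turb.ZerothLaw under B ↦ B̃, T³ ↦ (ℝ³, Schwartz force). Hence (support item
NonlinearityRobustNoAnomalyFails, the twin of
Literature.Barriers.AnomalousDissipation.Cheskidov2023_thm13_not_forceRobustNoAnomaly) the technique
class "no-anomaly conclusions stable under replacing B by any averaged B̃ with cancellation" is
refuted: a proof of Literature.Analysis.FluidPDE.ZerothLawNeg (route Neg) — or of Neg's cruxes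
Decorrelation / 'steady bounded-energy branches have vanishing dissipation' — using only the energy
identity, scaling and harmonic-analysis bounds on B would prove the averaged statement refuted here;
refutations of the summit must use fine structure of B (vorticity transport, exact pressure, 2-D
invariants, sign of backscatter), exactly as regularity proofs must (Tao 2016, Thm 1.5).

## Thesis X (Lean, one line; elaborates, Sketch.lean `AveragedZerothLaw`)
∃ 𝒜 : Tao2016.AveragingDatum, 𝒜.IsSymmetric ∧ 𝒜.HasCancellation ∧ ∃ f : 𝓢(ℝ³,ℝ³),
VectorCalculus.IsDivFree ⇑f ∧ ∃ ν u₀ u, (∀ j, 0 < ν j) ∧ Tendsto ν atTop (𝓝 0) ∧ (∀ j, MemH10df (u₀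
j)) ∧ (∀ j, u j : [0,∞) → H¹⁰_df continuous with ⟨u j t, w⟩ = ⟨heat (ν j t) (u₀ j), w⟩ + ∫₀ᵗ (𝒜.form
(u j s) (u j s) (heat (ν j (t−s)) w) + ⟨schwartzL2 f, heat (ν j (t−s)) w⟩) ds for all w ∈ H¹⁰_df) ∧
(∃ E, ∀ j, longTimeAvgSup (t ↦ ‖u j t‖²) ≤ E) ∧ ∃ ε > 0, ∀ j, ε ≤ longTimeAvgSup (t ↦ ν j · 4π²
(eHomSobolevSeminorm 1 (u j t))²). All constants exist
(Literature.Analysis.FluidPDE.Tao2016.{AveragingDatum, form, IsSymmetric, HasCancellation, L2C,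
MemH10df, ContinuousInH10On, pairing, heat, schwartzL2},
Literature.Analysis.FluidPDE.{VectorCalculus.IsDivFree, longTimeAvgSup},
Literature.Analysis.FunctionSpaces.eHomSobolevSeminorm).

## Mechanism (two layers: crux statements now, glue later)
THE WITNESSES ARE STEADY CASCADE STATES. Take Tao's §4 cascade operator C =
Tao2016.cascadeOperatorForm ε₀ ψ α with ONE wavelet family (m = 1) and the
Desnyansky–Novikov/Katz–Pavlović structure constants α(0,0,1) = 1, α(0,1,0) = α(1,0,0) = −½,
α(0,0,0) = 0 (symmetric (4.2) and cancelling (4.3); proved lemmas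
isLocalCascadeForm_cascadeOperatorForm, cascadeOperatorForm_symm, cascadeOperatorForm_cancel); by
the PROVED in-tree Theorem 3.2 (Tao2016.localCascade_isAveraged_holds, axioms clean) C = B̃_𝒜 on
H¹⁰_df for ε₀ below an absolute threshold. For the forced viscous cascade PDE νΔU + C(U,U) + f₀ψ₀ =
0 with the TRUE Laplacian the ansatz U = Σ_{k≥0} (a_k λ^{2k}/θ)(−Δ)⁻¹ψ_k, λ = 1+ε₀, θ =
∫|ψ̂|²/(4π²|ξ|²), is EXACT — the wavelet shells are Fourier-disjoint and (−Δ)⁻¹ preserves each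
annulus, so the true-Laplacian leakage between modes that obstructs the time-dependent transplant is
absent — and it reduces to the Cheskidov–Friedlander steady recursion (ν/θ)λ^{2k}a_k −
λ^{5(k−1)/2}a_{k−1}² + λ^{5k/2}a_k a_{k+1} = f₀δ_{k0} at c = 5/2 (the Bernstein-saturated endpoint
of CF's range (3/2, 5/2]), with ‖U‖² ≤ 2Σa_k² and ν‖∇U‖² = f₀a₀ exactly. CF 2009 §2 (positivity
Lemma 2.1, monotonicity Thm 2.2, A_j → 1 Lemma 2.3) gives sup_ν Σa_k² < ∞ and inf_ν a₀ > 0, i.e. X.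
Ranked: crux 2 CascadeSteadyLift (the exact lift; load-bearing and new), crux 3 DyadicSteadyBranch
(CF §2 ported to shell ratio λ ∈ (1,2], c = 5/2, including the existence CF leave to 'standard
techniques'), crux 4 CascadeRestZerothLaw (the DYNAMIC zeroth law from rest for the same PDE — the
card's original B1, where leakage is real; strengthening, deliberately NOT load-bearing). Assembly =
CascadeSteadyLift → DyadicSteadyBranch → X (glue only: nonempty_cascadeWaveletData, Thm 3.2 to swap
C for 𝒜.form inside the Duhamel integral, long-time means of constants).

Rationale: WHY THIS LINE. The summit's negative side (route Neg: ZerothLawNeg, Decorrelation, SteadyNoAnomaly)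
is where refuters spend effort; the only catalogued no-go for it is FORCE-robustness (Cheskidov2023
Thm 1.3). This route builds the orthogonal no-go — NONLINEARITY-robustness — by transplanting the
one proved fixed-force cascade zeroth law (CheskidovFriedlander2009, dyadic model, Thm 4.2/§2) into
Tao's averaged-NS class (Tao2016AveragedNS Def 3.1, Thms 3.2–3.3), whose whole §3–§4 machinery is
PROVED in-tree (localCascade_isAveraged_holds; cascadeOperatorForm_symm/_cancel;
nonempty_cascadeWaveletData). Imported areas: shell-model dynamics (CF 2009, Cheskidov2008,
BarbatoMorandinRomito2011) + Tao's harmonic-analysis averaging. Sharpening found while planning: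
STEADY witnesses make the transplant exact with the true Laplacian (ansatz U = Σ c_k (−Δ)⁻¹ψ_k), so
the deliverable X rests on an ODE fixed-point problem, not on attractor robustness.
RANKED CRUXES. (2) CascadeSteadyLift — exact steady lift, ‖U‖² ≤ 2Σa², ν‖∇U‖² ≥ f₀a₀; fails if
shells overlap or (−Δ)⁻¹ψ leaves the annulus, or if the Duhamel form of steadiness hides a
convergence gap (n → −∞ weights, H¹⁰ decay). (3) DyadicSteadyBranch — CF §2 at c = 5/2, λ ∈ (1,2]:
existence (unproved in print), positivity, monotonicity (uses λ^{1/3} < 2), uniform ℓ² bound and a₀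
≥ ε from monotonicity alone. (4) CascadeRestZerothLaw — dynamic version from rest (limsup means, all
global mild solutions), uniform in ν ≤ ν₀: CF Thm 3.4/4.2 plus robustness to Tao's Lemma-4.1
leakage; genuinely open; not load-bearing.
SUPPORT. NonlinearityRobustNoAnomalyFails = ¬(technique class) follows from X by instantiation
(checked in Sketch.lean); it is the decl a Literature/Barriers/AnomalousDissipation entry should
re-export once X_holds lands (card item B2; librarian task, not filed here).
KILL CRITERIA. X is expected TRUE. The route closes `exhausted` if crux 3's existence/uniform bounds
fail at ratio λ → 1 (then restate at λ = 2 with Tao's annulus widened — impossible inside Def 3.1 —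
i.e. the line dies), or `refuted:CascadeSteadyLift` if the lift identity is wrong as typed (repair
by restating constants). A refutation of crux 4 does NOT kill the route (drop it; it is the stretch
statement). Superseded if a Literature barrier file proves ¬(technique class) directly.
NOT DECOMPOSED YET. Torus version (B̃ has no T³ analogue: dilations), Leray–Hopf (energy-class)
solution concept for the averaged system, the attractor/uniqueness theory behind crux 4 (Tao Lemma
4.1 defect terms vs CF positivity), Sabra/backscatter rung (card sabra-rung-monotonicity-test),
quantitative ε(λ,f₀) = λ^{5/12}f₀^{3/2}(1+o(1)).
NOVELTY: see --novelty (nearest: Tao2016AveragedNS Thm 1.5/3.2 = arXiv:1402.0290;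
CheskidovFriedlander2009 = arXiv:0810.3718; delta = first forced/long-time use of Tao's class, exact
steady realisation of the dyadic fixed point in a PDE with NS's estimate profile, read as a
nonlinearity-robust no-go; card graded new-combination twice).
BARRIERS: see --barriers (Cheskidov2023_thm13_not_forceRobustNoAnomaly is the sibling,
complementary; witness-side barriers n/a — no NS witness is claimed; DrivasEyink-type regularity
obstructions respected: a_k ~ λ^{-5k/6} puts the family uniformly in B^{5/6}_{2,∞} ⊂ B^{1/3}_{3,∞},
exactly Onsager-critical and not better).

Novelty: Nearest prior art: (1) Tao2016AveragedNS = arXiv:1402.0290 = doi:10.1090/jams/838 — Def 3.1, Thm 3.2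
(local cascade operators are averages of B; the KP/DN chain is the m = 1 case, §1.2 p. 9, p. 23),
Thm 1.5 read as a no-go for REGULARITY proofs only; (2) CheskidovFriedlander2009 = arXiv:0810.3718 =
doi:10.1016/j.physd.2009.01.011 — §2 steady state (positivity Lemma 2.1, monotonicity Thm 2.2, A_j →
1 Lemma 2.3) and Thm 4.2 (long-time zeroth law of the viscous dyadic model, steady force on shell 0,
c ∈ (3/2,5/2], λ = 2), with CheskidovFriedlanderPavlovic2007 = doi:10.1063/1.2395917; (3)
Cheskidov2023 = arXiv:2311.04182 Thm 1.3 and the in-tree FORCE-robust no-go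
Literature.Barriers.AnomalousDissipation.Cheskidov2023_thm13_not_forceRobustNoAnomaly; (4)
Barbato–Bianchi–Flandoli–Morandin 2013 doi:10.1063/1.4792488 (tree dyadic, nearest 'spatialised'
dyadic anomaly, inviscid); (5) BarbatoMorandinRomito2011, Cheskidov2008 (viscous dyadic
regularity/blow-up, λ-sensitivity per Tao §1.2). DELTA (new-combination; the card was graded so by
two audits on 2026-08-15): Tao's averaging device, built to block energy-method regularity proofs,
is pointed at the NEGATIVE side of the zeroth law — a forced, long-time statement for an averaged NS
(none exists in print) read as a NONLINEARITY-robust no-go; planner's sharpening: STEADY witnesses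
via the exact ansatz U = Σ c_k (−Δ)⁻¹ψ_k (shells Fourier-disjoint, (−Δ)⁻¹ annulus-preserving), which
removes the true-Laplacian leakage the card flagged as it  [refs: 10.1090/jams/838, 10.1016/j.physd.2009.01.011, 10.1063/1.2395917, 10.1063/1.4792488, 1402.0290, 0810.3718, 2311.04182, doi:10.1090/jams/838, doi:10.1016/j.physd.2009.01.011, doi:10.1063/1.2395917, doi:10.1063/1.4792488, CheskidovFriedlander2009, CheskidovFriedlanderPavlovic2007, Cheskidov2023, BarbatoMorandinRomito2011, Cheskidov2008]

Barriers (technique_class: neg-route barrier tao-averaging shell-model steady-states): Literature.Barriers.AnomalousDissipation.Cheskidov2023_thm13_not_forceRobustNoAnomaly: the SIBLING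
no-go (force-robust energy estimates cannot prove ZerothLawNeg, because ν-dependent C(ℝ;L²)-close
forces give a long-time anomaly); this route is complementary and orthogonal — it keeps ONE exactly
ν-independent steady Schwartz force and perturbs the NONLINEARITY inside Tao's averaged class (B ↦
B̃ = 𝒜.form with cancellation), so together they pincer route Neg: an argument for ZerothLawNeg must
use both the exact force class AND fine structure of B. Nothing to evade: the route proves a no-go,
it does not attempt ZerothLawNeg. Its own scope caveats (stated up front for the refuter): ℝ³ with
Schwartz force and H¹⁰_df mild solutions instead of T³ Leray–Hopf; witnesses are steady (so they
also block the B̃-twins of Neg's steady crux and of CoherentStates' SteadyZerothLaw-negation); B̃ is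
a genuine Tao average only for ε₀ below the absolute threshold of Thm 3.2 (in-tree
localCascade_isAveraged_holds), which the Assembly respects.
Literature.Barriers.AnomalousDissipation.DrivasEyink2019_lemma1: respected, not evaded — the steady
cascade states have a_k ≍ λ^{-5k/6}A_k with A_k ≤ A_0 bounded, i.e. they are uniformly bounded
exactly in the Onsager-critical class B^{5/6}_{2,∞} ⊂ B^{1/3}_{3,∞} and in nothing better (the
viscous cap moves to k_ν → ∞), as any family with a dissipation floor must be.
Literature.Barriers.AnomalousDissipation.BrueDeLellis2023_noAnomaly_beforeEulerSingularity, L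

Novelty grade: new-combination — ROUTE REVIEW grade (refuter 2f46c378, 2026-08-15; concurring 2nd opinion after 9bee0ce5's full review; the realised card was already graded new-combination by two audits today). The two joined ingredients: (1) Tao's averaged-Navier–Stokes class and the in-tree PROVED Thm 3.2 (local cascade operators (refuter refuter-rreview-route-HubbardSuperconduc-2f46c378-0, 2026-08-15T12:20:02Z; prior: Tao2016AveragedNS doi:10.1090/jams/838 (arXiv:1402.0290) Def 3.1, Thm 3.2, S4, CheskidovFriedlander2009 doi:10.1016/j.physd.2009.01.011 (arXiv:0810.3718) S2, Thm 4.2, CheskidovFriedlanderPavlovic2007 doi:10.1063/1.2395917, Cheskidov2023 arXiv:2311.04182 Thm 1.3, BarbatoBianchiFlandoliMorandin2013 doi:10.1063/1.4792488, arXiv:2209.10203 Thm 22 (Cheskidov-Dai-Friedlander survey))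

History (route lifecycle, newest last):
- 2026-08-15T13:36:04Z · CLOSED retired — not-a-thesis: assembly does not conclude the sub-problem Statement (operator:999:1090267)

sub-problem: AnomalousDissipation · status: closed(retired) · opened planner-plancard-AnomalousDissipation-Anomalo-d22fd9cd-0 2026-08-15T10:54:19Z · rev 1 · ledger route-AnomalousDissipation-AveragedCascade
GENERATED by the gate from the ledger (D-0016/17). Provers cite these decls: `theorem foo : Summit.AnomalousDissipation.AnomalousDissipation.Theses.AveragedCascade.<Decl> := …` in Summits/AnomalousDissipation/AnomalousDissipation/Theorems/<Name>.lean.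
-/

namespace Summit.AnomalousDissipation.AnomalousDissipation.Theses.AveragedCascade

open scoped BigOperators Topology Manifold Classical MeasureTheory ProbabilityTheory Matrix InnerProductSpace ComplexConjugate ContinuousMap
open Filter Set Function TopologicalSpace MeasureTheory

attribute [summit_statement] _root_.AnomalousDissipation

open Literature.Turb

/-- item stmt-AnomalousDissipation-1279 · target · rank 0 · closed · moot by None · by planner
why it might fail: Expected TRUE (steady cascade states are witnesses); fails only as typed: the Duhamel clause (heat(νt), bilinear pairing, schwartzL2 f vs cascadeWavelet 0), the functional 4π²·eHomSobolevSeminorm² (= ‖∇u‖²: no 2π inside the seminorm, checked), or Thm 3.2's H¹⁰_df-only identity missing a test vector.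
sources: Tao2016AveragedNS, arXiv:1402.0290 Thm 1.5, Thm 3.2 (p. 14), §4 pp. 21-22, CheskidovFriedlander2009, arXiv:0810.3718 §2, Thm 4.2
[target] AVERAGED ZEROTH LAW (twin of Literature.Turb.ZerothLaw under B ↦ B̃, T³ ↦ ℝ³): some
symmetric Tao-averaged Euler operator B̃ = 𝒜.form with cancellation ⟨B̃(u,u),u⟩ = 0, one steady
Schwartz div-free force f, viscosities ν_j → 0 and global mild H¹⁰_df solutions u_j of ∂ₜu = ν_jΔu +
B̃(u,u) + f (Duhamel form with Tao2016.heat, data u₀ j ∈ H¹⁰_df) with bounded limsup-mean energy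
⟨‖u_j‖²⟩ ≤ E and limsup-mean dissipation ⟨ν_j·4π²‖u_j‖²_{Ḣ¹}⟩ ≥ ε > 0. Expected TRUE (witnesses:
steady cascade states). Why it might fail as typed: the mild/Duhamel clause with heat(ν t) and
Schwartz force must match the steady lift exactly (constants 4π², eHomSobolevSeminorm). Sources:
Tao2016AveragedNS Thm 1.5/3.2 (arXiv:1402.0290); CheskidovFriedlander2009 Thm 4.2 (arXiv:0810.3718). -/
@[route_item "route-AnomalousDissipation-AveragedCascade"]
def AveragedZerothLaw : Prop :=
  open Literature.Analysis.FluidPDE in ∃ 𝒜 : Tao2016.AveragingDatum, 𝒜.IsSymmetric ∧ 𝒜.HasCancellation ∧ ∃ f : SchwartzMap (EuclideanSpace ℝ (Fin 3)) (EuclideanSpace ℝ (Fin 3)), VectorCalculus.IsDivFree ⇑f ∧ ∃ (ν : ℕ → ℝ) (u₀ : ℕ → Tao2016.L2C) (u : ℕ → ℝ → Tao2016.L2C), (∀ j, 0 < ν j) ∧ Tendsto ν atTop (𝓝 0) ∧ (∀ j, Tao2016.MemH10df (u₀ j)) ∧ (∀ j, (∀ t, 0 ≤ t → Tao2016.MemH10df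 (u j t)) ∧ Tao2016.ContinuousInH10On (Ici 0) (u j) ∧ ∀ t, 0 ≤ t → ∀ w, Tao2016.MemH10df w → Tao2016.pairing (u j t) w = Tao2016.pairing (Tao2016.heat (ν j * t) (u₀ j)) w + ∫ s in (0:ℝ)..t, (𝒜.form (u j s) (u j s) (Tao2016.heat (ν j * (t - s)) w) + Tao2016.pairing (Tao2016.schwartzL2 f) (Tao2016.heat (ν j * (t - s)) w))) ∧ (∃ E : ℝ, ∀ j, longTimeAvgSup (fun t => ‖u j t‖ ^ 2) ≤ E) ∧ ∃ ε : ℝ, 0 < ε ∧ ∀ j, ε ≤ longTimeAvgSup (fun t => ν j * (4 * Real.pi ^ 2 * (Literature.Analysis.FunctionSpaces.eHomSobolevSeminorm 1 (u j t)).toReal ^ 2))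

/-- item stmt-AnomalousDissipation-1280 · crux · rank 2 · closed · moot by None · by planner
why it might fail: Paper identity checks shell by shell (X_n = a_n, θ₂/θ² ≤ (1+ε₀/2)² < 2, ν·4π²‖U‖²_{Ḣ¹} = f₀a₀); risk is as typed: θ via fourierFn∘schwartzL2, bilinear pairing needs ψ̂ Hermitian, IsReal/IsFourierDivFree of (−Δ)⁻¹ψ_n, tsum convergence in cascadeOperatorForm, weight (1+ε₀)^{20n} for H¹⁰.
sources: Tao2016AveragedNS, arXiv:1402.0290 §4 (4.1)-(4.3) p. 21; Lemma 4.1 (iii)-(iv) pp. 21-22 (leakage is a time-integrated defect, absent for the steady ansatz), CheskidovFriedlander2009, arXiv:0810.3718 §2 p. 5 (energy identity of the steady system)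
[crux] EXACT STEADY LIFT with the TRUE Laplacian. For ε₀ ∈ (0,1/4], Tao §4 wavelet data 𝒟 (m = 1; ψ̂
supported in balls B ∪ −B ⊂ {1 < |ξ| ≤ 1+ε₀/2}, real, ‖ψ‖₂ = 1, div-free), θ := ∫|ψ̂|²/(4π²|ξ|²) >
0, and the DN structure constants α(0,0,1)=1, α(0,1,0)=α(1,0,0)=−½: every real sequence (a_n)_{n≥0}
with Σ(1+ε₀)^{20n}a_n² < ∞ solving the steady dyadic recursion (ν/θ)λ^{2n}a_n − λ^{5(n−1)/2}a_{n−1}²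
+ λ^{5n/2}a_n a_{n+1} = f₀δ_{n0} (λ = 1+ε₀) lifts to U ∈ H¹⁰_df (intended U = Σ_n
(a_nλ^{2n}/θ)(−Δ)⁻¹ψ_n) which is a STEADY mild solution of ∂ₜu = νΔu + C(u,u) + f₀ψ₀ (C =
Tao2016.cascadeOperatorForm ε₀ 𝒟.ψ α; Duhamel identity for the constant trajectory against all w ∈
H¹⁰_df, all t ≥ 0) with ‖U‖² ≤ 2Σa_n² and f₀a₀ ≤ ν·4π²‖U‖²_{Ḣ¹} (in truth equality: dissipation =
input). Mechanism: shells (1+ε₀)ⁿ(B ∪ −B) are pairwise disjoint (in-tree pairing_cascadeWavelet),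
(−Δ)⁻¹ preserves each annulus, ⟨(−Δ)⁻¹ψ_n, ψ_n⟩ = θλ^{-2n}, so νΔU + C(U,U) + f₀ψ₀ = 0 holds shell
by shell; no leakage. Why it might fail: see why_might_fail. Sources: Tao2016AveragedNS §4
(4.1)–(4.3), Lemma 4.1; CheskidovFriedlander2009 §2. -/
@[route_item "route-AnomalousDissipation-AveragedCascade"]
def CascadeSteadyLift : Prop :=
  open Literature.Analysis.FluidPDE in ∀ ε₀ : ℝ, 0 < ε₀ → ε₀ ≤ 1 / 4 → ∀ 𝒟 : Tao2016.CascadeWaveletData ε₀ 1, let θ : ℝ := ∫ ξ, ‖Tao2016.fourierFn (Tao2016.schwartzL2 (𝒟.ψ 0)) ξ‖ ^ 2 / (4 * Real.pi ^ 2 * ‖ξ‖ ^ 2); 0 < θ ∧ ∀ ν f₀ : ℝ, 0 < ν → 0 < f₀ → ∀ a : ℕ → ℝ, (Summable fun n : ℕ => (1 + ε₀) ^ ((20 : ℝ) * n) * a n ^ 2) → (∀ n : ℕ, ν / θ * (1 + ε₀) ^ ((2 : ℝ) * n) * a n - (if n = 0 then 0 else (1 + ε₀) ^ ((5 : ℝ)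 * ((n : ℝ) - 1) / 2) * a (n - 1) ^ 2) + (1 + ε₀) ^ ((5 : ℝ) * n / 2) * a n * a (n + 1) = if n = 0 then f₀ else 0) → ∃ U : Tao2016.L2C, Tao2016.MemH10df U ∧ (∀ t : ℝ, 0 ≤ t → ∀ w, Tao2016.MemH10df w → Tao2016.pairing U w = Tao2016.pairing (Tao2016.heat (ν * t) U) w + ∫ s in (0:ℝ)..t, (Tao2016.cascadeOperatorForm ε₀ 𝒟.ψ (fun (_ _ _ : Fin 1) (μ : ℤ × ℤ × ℤ) => if μ = (0, 0, 1) then (1 : ℝ) else if μ = (0, 1, 0) ∨ μ = (1, 0, 0) then -(1 / 2 : ℝ) else 0) U U (Tao2016.heat (ν * (t - s)) w) + Tao2016.pairing ((f₀ : ℂ) • Tao2016.cascadeWavelet ε₀ (𝒟.ψ 0) 0) (Tao2016.heat (ν * (t - s)) w))) ∧ ‖U‖ ^ 2 ≤ 2 * ∑' n, a n ^ 2 ∧ f₀ * a 0 ≤ ν * (4 * Real.pi ^ 2 * (Literature.Analysis.FunctionSpaces.eHomSobolevSeminorm 1 U).toReal ^ 2)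

/-- item stmt-AnomalousDissipation-1282 · crux · rank 4 · closed · moot by None · by planner
why it might fail: True-Laplacian leakage (Tao L4.1(iii)-(iv): sign-indefinite O((1+ε₀)^{2n}E^{1/2}) defect) voids the exact positivity/nearest-neighbour structure CF Thm 3.4 runs on; at c = 5/2 even the noisy dyadic zeroth law is known only for c < 2 (FGV2016 Thm 6.1); no uniform-in-ν attractor theory; maybe vacuous.
sources: CheskidovFriedlander2009, arXiv:0810.3718 Thm 3.4, Thm 4.2 (pp. 6-7), Tao2016AveragedNS, arXiv:1402.0290 Lemma 4.1 (iii)-(iv) pp. 21-22, arXiv:1404.1098 Thm 6.1 (Friedlander-Glatt-Holtz-Vicol: dissipation anomaly for the stochastically forced dyadic model, c ∈ [1,2) only), BarbatoMorandinRomito2011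
[crux] DYNAMIC ZEROTH LAW FROM REST for the forced viscous DN cascade PDE (the card's original B1;
STRENGTHENING — not in the Assembly chain, droppable if refuted): for ε₀ ∈ (0,1/4], wavelet data 𝒟,
f₀ > 0 there are ν₀, E, ε > 0 such that for all ν ∈ (0,ν₀] EVERY global mild H¹⁰_df solution u of
∂ₜu = νΔu + C(u,u) + f₀ψ₀ with u(0) = 0 (true Laplacian, C as in CascadeSteadyLift) has limsup-mean
energy ≤ E and limsup-mean dissipation ν·4π²⟨‖u‖²_{Ḣ¹}⟩ ≥ ε. This is Cheskidov–Friedlander Thm 4.2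
(global attractor = steady state, time-averaged dissipation → ε_d > 0) transplanted WITH leakage:
the true Laplacian couples the wavelet coefficients X_n = ⟨u,ψ_n⟩ to the orthogonal remainder
through O(ε₀νλ^{2n}) terms (Tao's Lemma 4.1 defects), possibly destroying the sign condition X_n ≥ 0
on which CF's attractor proof (Thm 3.4) runs. Upgrades the barrier from 'steady branches' to 'the
attracting statistics'. Vacuity note: conditional on global mild solutions from rest existing
(global regularity of the c = 5/2 cascade PDE at ratio 1+ε₀ is itself not in print, cf. BMR 2011 /
Tao §1.2). Sources: CheskidovFriedlander2009 Thms 3.4, 4.2; Tao2016AveragedNS Lemma 4.1;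
BarbatoMorandinRomito2011 Thm 1 -/
@[route_item "route-AnomalousDissipation-AveragedCascade"]
def CascadeRestZerothLaw : Prop :=
  open Literature.Analysis.FluidPDE in ∀ ε₀ : ℝ, 0 < ε₀ → ε₀ ≤ 1 / 4 → ∀ 𝒟 : Tao2016.CascadeWaveletData ε₀ 1, ∀ f₀ : ℝ, 0 < f₀ → ∃ ν₀ E ε : ℝ, 0 < ν₀ ∧ 0 < ε ∧ ∀ ν : ℝ, 0 < ν → ν ≤ ν₀ → ∀ u : ℝ → Tao2016.L2C, ((∀ t, 0 ≤ t → Tao2016.MemH10df (u t)) ∧ Tao2016.ContinuousInH10On (Ici 0) u ∧ ∀ t, 0 ≤ t → ∀ w, Tao2016.MemH10df w → Tao2016.pairing (u t) w = Tao2016.pairing (Tao2016.heat (ν * t) 0) w + ∫ s in (0:ℝ)..t, (Tao2016.cascadeOperatorForm ε₀ 𝒟.ψ (fun (_ _ _ : Fin 1) (μ : ℤ × ℤ × ℤ) => if μ = (0, 0, 1) then (1 : ℝ) else if μ = (0, 1, 0) ∨ μ = (1, 0, 0) then -(1 / 2 : ℝ) else 0) (u s) (u s) (Tao2016.heat (ν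 * (t - s)) w) + Tao2016.pairing ((f₀ : ℂ) • Tao2016.cascadeWavelet ε₀ (𝒟.ψ 0) 0) (Tao2016.heat (ν * (t - s)) w))) → longTimeAvgSup (fun t => ‖u t‖ ^ 2) ≤ E ∧ ε ≤ longTimeAvgSup (fun t => ν * (4 * Real.pi ^ 2 * (Literature.Analysis.FunctionSpaces.eHomSobolevSeminorm 1 (u t)).toReal ^ 2))

/-- item stmt-AnomalousDissipation-1281 · support · rank 3 · closed · moot by None · by planner
why it might fail: CF2009 §2 asserts existence without proof ('standard NS techniques') and hard-wires λ = 2 (monotonicity uses λ^β < 2); here c = 5/2 is the endpoint of their range (3/2,5/2] and lam → 1 makes the ℓ² bound degenerate like (1 − lam^{-5/3})⁻¹ — uniformity in ν ∈ (0,1] must come from monotonicity alone.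
sources: CheskidovFriedlander2009, arXiv:0810.3718 §2 pp. 5-6 (Lemma 2.1, Thm 2.2, Lemmas 2.3-2.4), arXiv:2209.10203 Thm 22 (Cheskidov-Dai-Friedlander survey: unique viscous fixed point, global attractor, ε^ν → ε > 0), Literature.Topology.Euclidean.Brouwer.exists_zero_of_inner_nonneg_on_sphere, CheskidovFriedlanderPavlovic2007
[crux] CHESKIDOV–FRIEDLANDER STEADY BRANCH at c = 5/2, shell ratio lam ∈ (1,2]: for every f₀ > 0
there are E, ε > 0 such that for EVERY ν ∈ (0,1] the steady dyadic system νlam^{2n}a_n −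
lam^{5(n−1)/2}a_{n−1}² + lam^{5n/2}a_n a_{n+1} = f₀δ_{n0} (n ≥ 0, a_{−1} := 0) has a solution with
a_n > 0, super-exponential decay (∀ s, Σ lam^{sn}a_n² < ∞), Σa_n² ≤ E and f₀a₀ ≥ ε. Proof plan (CF
2009 §2, written for λ = 2): existence by Galerkin truncation + Brouwer (energy identity
νΣlam^{2n}a_n² = f₀a₀) + compactness; positivity of any decaying solution (Lemma 2.1); monotonicity
of A_j = lam^{5j/6}·const·a_j (Thm 2.2, uses lam^{1/3} < 2); then A₀(A₀+μ) > 1 and A₀⁴ < 1 +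
μlam^{1/3}A₀ bound A₀ two-sidedly, A_j ≤ A₀ and a_j ∝ lam^{-5j/6}A_j give the uniform ℓ² bound;
A_{J+k} ≤ lam^{-k/3}A_{J+k−1}² gives the decay. Sources: CheskidovFriedlander2009 §2 (Lemma 2.1, Thm
2.2, Lemmas 2.3–2.4), CheskidovFriedlanderPavlovic2007 (inviscid fixed point), Cheskidov2008 §3–4
(viscous dyadic framework). -/
@[route_item "route-AnomalousDissipation-AveragedCascade"]
def DyadicSteadyBranch : Prop :=
  ∀ lam : ℝ, 1 < lam → lam ≤ 2 → ∀ f₀ : ℝ, 0 < f₀ → ∃ E ε : ℝ, 0 < ε ∧ ∀ ν : ℝ, 0 < ν → ν ≤ 1 → ∃ a : ℕ → ℝ, (∀ n, 0 < a n) ∧ (∀ s : ℝ, Summable fun n : ℕ => lam ^ (s * n) * a n ^ 2) ∧ (∀ n : ℕ, ν * lam ^ ((2 : ℝ) * n) * a n - (if n = 0 then 0 else lam ^ ((5 : ℝ) * ((n : ℝ) - 1) / 2) * a (n - 1) ^ 2) + lam ^ ((5 : ℝ) * n / 2) * a n * a (n + 1) = if n = 0 then f₀ else 0) ∧ ∑'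 n, a n ^ 2 ≤ E ∧ ε ≤ f₀ * a 0

/-- item stmt-AnomalousDissipation-1283 · support · rank 9 · closed · moot by None · by planner
sources: Tao2016AveragedNS, Cheskidov2023
[support] THE BARRIER STATEMENT (twin of
Literature.Barriers.AnomalousDissipation.Cheskidov2023_thm13_not_forceRobustNoAnomaly): NOT (for
every symmetric averaged Euler operator 𝒜.form with cancellation, every steady Schwartz div-free
force, every ν_j → 0 and every family of global mild H¹⁰_df solutions with bounded limsup-mean
energy, the limsup-mean dissipation ν_j·4π²⟨‖u_j‖²_{Ḣ¹}⟩ tends to 0) — i.e. the technique class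
'no-anomaly arguments stable under B ↦ B̃' proves a false statement. Follows from AveragedZerothLaw
by instantiation (checked in the planner's Sketch.lean); filed so that the no-go has a citable decl
for a Literature/Barriers entry. Sources: Tao2016AveragedNS §1.1 pp. 6–8; Cheskidov2023 Thm 1.3 (the
force-robust sibling). -/
@[route_item "route-AnomalousDissipation-AveragedCascade"]
def NonlinearityRobustNoAnomalyFails : Prop :=
  open Literature.Analysis.FluidPDE in ¬ (∀ 𝒜 : Tao2016.AveragingDatum, 𝒜.IsSymmetric → 𝒜.HasCancellation → ∀ f : SchwartzMap (EuclideanSpace ℝ (Fin 3)) (EuclideanSpace ℝ (Fin 3)), VectorCalculus.IsDivFree ⇑f → ∀ (ν : ℕ → ℝ) (u₀ : ℕ → Tao2016.L2C) (u : ℕ → ℝ → Tao2016.L2C), (∀ j, 0 < ν j) → Tendsto ν atTop (𝓝 0) → (∀ j, Tao2016.MemH10df (u₀ j)) → (∀ j, (∀ t, 0 ≤ t → Tao2016.MemH10df (u j t)) ∧ Tao2016.ContinuousInH10On (Ici 0) (u j) ∧ ∀ t, 0 ≤ t → ∀ w, Tao2016.MemH10df w → Tao2016.pairing (u j t) w =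 Tao2016.pairing (Tao2016.heat (ν j * t) (u₀ j)) w + ∫ s in (0:ℝ)..t, (𝒜.form (u j s) (u j s) (Tao2016.heat (ν j * (t - s)) w) + Tao2016.pairing (Tao2016.schwartzL2 f) (Tao2016.heat (ν j * (t - s)) w))) → (∃ E : ℝ, ∀ j, longTimeAvgSup (fun t => ‖u j t‖ ^ 2) ≤ E) → Tendsto (fun j => longTimeAvgSup (fun t => ν j * (4 * Real.pi ^ 2 * (Literature.Analysis.FunctionSpaces.eHomSobolevSeminorm 1 (u j t)).toReal ^ 2))) atTop (𝓝 0))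

/-- item stmt-AnomalousDissipation-1284 · assembly · rank 1 · closed · moot by None · by planner
sources: Tao2016AveragedNS, CheskidovFriedlander2009
[assembly] CascadeSteadyLift → DyadicSteadyBranch → AveragedZerothLaw. Glue only: ε₀ := min(¼, ε₁)
with ε₁ from the PROVED Thm 3.2 (Tao2016.localCascade_isAveraged_holds); 𝒟 from
nonempty_cascadeWaveletData; C := cascadeOperatorForm ε₀ 𝒟.ψ α_DN is a local cascade form
(isLocalCascadeForm_cascadeOperatorForm), symmetric and cancelling (cascadeOperatorForm_symm/_cancel
with IsSymmetricCoeff/IsCancellingCoeff of α_DN, both `decide`-level); Thm 3.2 gives 𝒜 with 𝒜.form =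
C on H¹⁰_df × H¹⁰_df × (H¹⁰_df ⊗ ℂ), hence 𝒜 symmetric with cancellation and the Duhamel integrand
may be rewritten (test vectors e^{τΔ}w ∈ H¹⁰_df ⊗ ℂ, MemH10dfC.heat); f := 𝒟.ψ 0 (f₀ = 1; schwartzL2
f = cascadeWavelet ε₀ ψ 0 by dil_one); ν_j := θ/(j+2) → 0 (θ > 0 from CascadeSteadyLift);
DyadicSteadyBranch at lam = 1+ε₀, ν' = 1/(j+2) gives a^{(j)}; CascadeSteadyLift lifts to steady U_j;
u j t := U_j, u₀ j := U_j; longTimeAvgSup of constants; E_X = 2E, ε_X = ε. -/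
@[route_item "route-AnomalousDissipation-AveragedCascade"]
def Assembly : Prop :=
  CascadeSteadyLift → DyadicSteadyBranch → AveragedZerothLaw

end Summit.AnomalousDissipation.AnomalousDissipation.Theses.AveragedCascade
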